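import Literature.AlgebraicGeometry.Motives.AbelianVarietyBaseChangeSchemeMaps
import HarnessLib

/-!
# Semilinear homomorphisms `A → A` over a field automorphism: `φ ≫ (A^σ → A)` for `φ : A → A^σ`
# (Shimura 1998, §21.4 proof of Thm. 21.4 pp. 147–148: `λ_σ : A → A^σ`; Görtz–Wedhorn I, §(14.20): descent data `σ^*X → X`)

Topic `Literature/AlgebraicGeometry/Motives`, namespace `Literature.AlgebraicGeometry.Motives.AbelianVariety`.
THEOREMS ONLY (no definition, no named fact; net Literature debt 0).  Cell `hodgecm-mathlib`, fan A, rung A-II,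
line `a2b-twisted-galois-model`, stub TM.

A homomorphism `φ : A → A^σ` into the conjugate of `A` by `σ ∈ Aut(L)` (`AbelianVariety.conjugate`,
`Motives/AbelianVarietyConjugate`) is the same as a `σ`-SEMILINEAR endomorphism of the `L`-scheme `A`, namely
`f = φ ≫ (A^σ → A) : A → A` covering `Spec σ` (Görtz–Wedhorn's descent datum read covariantly; Shimura's
`x ↦ λ_σ(x)` followed by the identification of points of `A^σ` with points of `A`).  This file records that such an
`f` respects the group law of the `L`-group scheme `A` in the semilinear sense, and that these identities are
transported along isomorphisms of abelian varieties:

* `semilinear_comp_hom` (`f ≫ p = p ≫ Spec σ`), **`semilinear_mul`** (`(f × f) ≫ m = m ≫ f`, the product taken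
  over `Spec σ`), **`semilinear_one`** (`0 ≫ f = Spec σ ≫ 0`), **`semilinear_inv`** (`i ≫ f = f ≫ i`);
* **`semilinear_mul/one/inv_conj`**: if `f : A → A` satisfies these identities over `s : Spec L → Spec L` and
  `e : A ≅ B` is an isomorphism of abelian varieties over `L`, then so does `e⁻¹ ≫ f ≫ e : B → B`.

## References

* [Shimura1998] G. Shimura, *Abelian Varieties with Complex Multiplication and Modular Functions* (1998), §21.4
  proof of Thm. 21.4, pp. 147–148 («λ_σ … μ = μ^σ ∘ λ_σ»).
* [GortzWedhorn2020] U. Görtz, T. Wedhorn, *Algebraic Geometry I* (2nd ed. 2020), §(14.20) (descent data),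
  Remark 16.54.
-/

noncomputable section

open CategoryTheory CategoryTheory.Limits AlgebraicGeometry MonoidalCategory CartesianMonoidalCategory

universe u

namespace Literature.AlgebraicGeometry.Motives

namespace AbelianVariety

open scoped MonObj

set_option backward.isDefEq.respectTransparency false

/-! ## §1 `φ ≫ (A^σ → A)` is a semilinear homomorphism -/

section Semilinear

variable {L : Type u} [Field L] (σ : L ≃+* L) {A : AbelianVariety L} (φ : A ⟶ A.conjugate σ)

/-- `f = φ ≫ (A^σ → A)` covers `Spec σ`: `f ≫ p = p ≫ Spec σ`. [cite: GortzWedhorn2020, §(14.20)] -/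
@[reassoc]
theorem semilinear_comp_hom :
    (Hom.toSchemeHom φ ≫ baseChangeHomFst σ.toRingHom A.X) ≫ A.X.hom =
      A.X.hom ≫ Spec.map (CommRingCat.ofHom σ.toRingHom) := by
  rw [Category.assoc, baseChangeHomFst_comp_hom, ← Category.assoc]
  congr 1
  exact Over.w φ.hom.hom.hom

/-- **`(f × f) ≫ m = m ≫ f`** for `f = φ ≫ (A^σ → A)`, the product `f × f : A ×_L A → A ×_L A` being taken over
`Spec σ` (`φ` is a homomorphism and `m_{A^σ}` lies over `m_A`). [cite: Shimura1998, §21.4, proof of Thm. 21.4 (pp. 147–148)] [cite: GortzWedhorn2020, Remark 16.54] -/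
theorem semilinear_mul :
    pullback.map A.X.hom A.X.hom A.X.hom A.X.hom
        (Hom.toSchemeHom φ ≫ baseChangeHomFst σ.toRingHom A.X)
        (Hom.toSchemeHom φ ≫ baseChangeHomFst σ.toRingHom A.X)
        (Spec.map (CommRingCat.ofHom σ.toRingHom))
        (semilinear_comp_hom σ φ).symm (semilinear_comp_hom σ φ).symm ≫ μ[A.X].left =
      μ[A.X].left ≫ Hom.toSchemeHom φ ≫ baseChangeHomFst σ.toRingHom A.X := by
  have hφ : μ[A.X] ≫ φ.hom.hom.hom = (φ.hom.hom.hom ⊗ₘ φ.hom.hom.hom) ≫ μ[(A.conjugate σ).X] :=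
    IsMonHom.mul_hom (f := φ.hom.hom.hom)
  have hφ' : μ[A.X].left ≫ Hom.toSchemeHom φ =
      (φ.hom.hom.hom ⊗ₘ φ.hom.hom.hom).left ≫ μ[(A.conjugate σ).X].left := by
    rw [← Over.comp_left, ← Over.comp_left]
    exact congrArg CommaMorphism.left hφ
  rw [reassoc_of% hφ', mul_conjugate_left_comp_fst, tensorHom_left, ← Category.assoc]
  congr 1
  apply pullback.hom_ext
  · simp only [Category.assoc, pullback.lift_fst, pullback.lift_fst_assoc]
  · simp only [Category.assoc, pullback.lift_snd, pullback.lift_snd_assoc]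

/-- **`0_A ≫ f = Spec σ ≫ 0_A`** for `f = φ ≫ (A^σ → A)`. [cite: Shimura1998, §21.4, proof of Thm. 21.4 (pp. 147–148)] [cite: GortzWedhorn2020, Remark 16.54] -/
@[reassoc]
theorem semilinear_one :
    η[A.X].left ≫ Hom.toSchemeHom φ ≫ baseChangeHomFst σ.toRingHom A.X =
      Spec.map (CommRingCat.ofHom σ.toRingHom) ≫ η[A.X].left := by
  have hφ : η[A.X] ≫ φ.hom.hom.hom = η[(A.conjugate σ).X] := IsMonHom.one_hom (f := φ.hom.hom.hom)
  have hφ' : η[A.X].left ≫ Hom.toSchemeHom φ = η[(A.conjugate σ).X].left := by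
    rw [← Over.comp_left]
    exact congrArg CommaMorphism.left hφ
  rw [reassoc_of% hφ', one_conjugate_left_comp_fst]

/-- **`i_A ≫ f = f ≫ i_A`** for `f = φ ≫ (A^σ → A)`. [cite: Shimura1998, §21.4, proof of Thm. 21.4 (pp. 147–148)] [cite: GortzWedhorn2020, Remark 16.54] -/
@[reassoc]
theorem semilinear_inv :
    ι[A.X].left ≫ Hom.toSchemeHom φ ≫ baseChangeHomFst σ.toRingHom A.X =
      (Hom.toSchemeHom φ ≫ baseChangeHomFst σ.toRingHom A.X) ≫ ι[A.X].left := by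
  have hφ : ι[A.X] ≫ φ.hom.hom.hom = φ.hom.hom.hom ≫ ι[(A.conjugate σ).X] := GrpObj.inv_hom φ.hom.hom.hom
  have hφ' : ι[A.X].left ≫ Hom.toSchemeHom φ = Hom.toSchemeHom φ ≫ ι[(A.conjugate σ).X].left := by
    rw [← Over.comp_left, ← Over.comp_left]
    exact congrArg CommaMorphism.left hφ
  rw [reassoc_of% hφ', inv_conjugate_left_comp_fst, Category.assoc]

end Semilinear

/-! ## §2 Transport of semilinear homomorphisms along isomorphisms of abelian varieties -/

section Transport

variable {L : Type u} [Field L] {A B : AbelianVariety L} (e : A ≅ B) (f : A.X.left ⟶ A.X.left)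
  (s : Spec (.of L) ⟶ Spec (.of L)) (hf : f ≫ A.X.hom = A.X.hom ≫ s)

include hf in
/-- `e⁻¹ ≫ f ≫ e` covers the same `s`. [cite: GortzWedhorn2020, §(14.20)] -/
@[reassoc]
theorem semilinear_comp_hom_conj :
    (Hom.toSchemeHom e.inv ≫ f ≫ Hom.toSchemeHom e.hom) ≫ B.X.hom = B.X.hom ≫ s := by
  simp only [Category.assoc]
  rw [Over.w e.hom.hom.hom.hom]
  change Hom.toSchemeHom e.inv ≫ f ≫ A.X.hom = B.X.hom ≫ s
  rw [hf, ← Category.assoc]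
  congr 1
  exact Over.w e.inv.hom.hom.hom

/-- **Transport of `(f × f) ≫ m = m ≫ f` along an isomorphism `e : A ≅ B`.** [cite: GortzWedhorn2020, Remark 16.54] -/
theorem semilinear_mul_conj
    (hmul : pullback.map A.X.hom A.X.hom A.X.hom A.X.hom f f s hf.symm hf.symm ≫ μ[A.X].left = μ[A.X].left ≫ f) :
    pullback.map B.X.hom B.X.hom B.X.hom B.X.hom
        (Hom.toSchemeHom e.inv ≫ f ≫ Hom.toSchemeHom e.hom) (Hom.toSchemeHom e.inv ≫ f ≫ Hom.toSchemeHom e.hom) s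
        (semilinear_comp_hom_conj e f s hf).symm (semilinear_comp_hom_conj e f s hf).symm ≫ μ[B.X].left =
      μ[B.X].left ≫ Hom.toSchemeHom e.inv ≫ f ≫ Hom.toSchemeHom e.hom := by
  have hinv : μ[B.X].left ≫ Hom.toSchemeHom e.inv = (e.inv.hom.hom.hom ⊗ₘ e.inv.hom.hom.hom).left ≫ μ[A.X].left := by
    rw [← Over.comp_left, ← Over.comp_left]
    exact congrArg CommaMorphism.left (IsMonHom.mul_hom (f := e.inv.hom.hom.hom))
  have hhom : μ[A.X].left ≫ Hom.toSchemeHom e.hom = (e.hom.hom.hom.hom ⊗ₘ e.hom.hom.hom.hom).left ≫ μ[B.X].left := by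
    rw [← Over.comp_left, ← Over.comp_left]
    exact congrArg CommaMorphism.left (IsMonHom.mul_hom (f := e.hom.hom.hom.hom))
  rw [reassoc_of% hinv, ← reassoc_of% hmul, hhom, tensorHom_left, tensorHom_left]
  simp only [← Category.assoc]
  congr 1
  apply pullback.hom_ext
  · simp only [Category.assoc, pullback.lift_fst, pullback.lift_fst_assoc]
  · simp only [Category.assoc, pullback.lift_snd, pullback.lift_snd_assoc]

/-- **Transport of `0 ≫ f = s ≫ 0` along `e : A ≅ B`.** [cite: GortzWedhorn2020, Remark 16.54] -/
theorem semilinear_one_conj (hone : η[A.X].left ≫ f = s ≫ η[A.X].left) :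
    η[B.X].left ≫ Hom.toSchemeHom e.inv ≫ f ≫ Hom.toSchemeHom e.hom = s ≫ η[B.X].left := by
  have hinv : η[B.X].left ≫ Hom.toSchemeHom e.inv = η[A.X].left := by
    rw [← Over.comp_left]
    exact congrArg CommaMorphism.left (IsMonHom.one_hom (f := e.inv.hom.hom.hom))
  have hhom : η[A.X].left ≫ Hom.toSchemeHom e.hom = η[B.X].left := by
    rw [← Over.comp_left]
    exact congrArg CommaMorphism.left (IsMonHom.one_hom (f := e.hom.hom.hom.hom))
  rw [reassoc_of% hinv, reassoc_of% hone, hhom]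

/-- **Transport of `i ≫ f = f ≫ i` along `e : A ≅ B`.** [cite: GortzWedhorn2020, Remark 16.54] -/
theorem semilinear_inv_conj (hinv' : ι[A.X].left ≫ f = f ≫ ι[A.X].left) :
    ι[B.X].left ≫ Hom.toSchemeHom e.inv ≫ f ≫ Hom.toSchemeHom e.hom =
      (Hom.toSchemeHom e.inv ≫ f ≫ Hom.toSchemeHom e.hom) ≫ ι[B.X].left := by
  have hinv : ι[B.X].left ≫ Hom.toSchemeHom e.inv = Hom.toSchemeHom e.inv ≫ ι[A.X].left := by
    rw [← Over.comp_left, ← Over.comp_left]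
    exact congrArg CommaMorphism.left (GrpObj.inv_hom e.inv.hom.hom.hom)
  have hhom : ι[A.X].left ≫ Hom.toSchemeHom e.hom = Hom.toSchemeHom e.hom ≫ ι[B.X].left := by
    rw [← Over.comp_left, ← Over.comp_left]
    exact congrArg CommaMorphism.left (GrpObj.inv_hom e.hom.hom.hom.hom)
  rw [reassoc_of% hinv, reassoc_of% hinv', hhom]
  simp only [Category.assoc]

end Transport

end AbelianVariety

end Literature.AlgebraicGeometry.Motives

end
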